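import Mathlib
import Literature.AlgebraicGeometry.Resolution.LocalBlowup
import HarnessLib

/-!
# Route `RadicialJung`, crux `CleanModels` (stmt-15917) — (C-curve) sub-line: perfect residue fields at the closed centre over a perfect ground field

Lead `res-B-lead-1` g6 (plan `Cruxes/CleanModels/Lines/Sketch-memo-Ccurve-plan.md` §1 S5a; hypothesis `hPerf` of `Ccurve.persistForm2_of`).  OURS · counted 0.
Nothing here proves resolution in characteristic `p`; resolution in char `p` is NOT proved.

`residue_perfect_locAtCentre`: `k` perfect of characteristic `p`, `B'` a finitely generated `k`-subalgebra of `K` inside `O` on which the centre of `O` is a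
maximal ideal `𝔮` (this is the route's «zero-dimensional» hypothesis `hzd` applied to `B' ⊇ A`).  Then every element of `S' = O_{B',𝔮} = locAtCentre B' O` is a
`p`-th power modulo `𝔪_{S'}`: the residue field `B'/𝔮` is finite over `k` (Zariski), hence perfect, and `u = a/b ≡ (e₁/e₂)^p` with `e₁^p ≡ a`, `e₂^p ≡ b`.
-/

noncomputable section

set_option linter.dupNamespace false

open IsLocalRing Literature.AlgebraicGeometry.Resolution

namespace Summit.ResolutionOfSingularities.ResolutionOfSingularities.Theorems.RadicialJung.CleanModels.Ccurve

/-- **Perfect residue field at the closed centre.**  Over a perfect field `k` of characteristic `p`, if the centre of `O` on the finitely generated model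
`B' ⊇ A` is a maximal ideal (hypothesis `hzd`), every element of `locAtCentre B' O` is a `p`-th power modulo the maximal ideal. [folklore] -/
theorem residue_perfect_locAtCentre :
    ∀ (k : Type) [Field k] (K : Type) [Field K] [Algebra k K] [PerfectField k] (p : ℕ) [Fact p.Prime] [CharP k p]
    (O : ValuationSubring K) (A : Subalgebra k K), A.toSubring ≤ O.toSubring → A.FG →
    (∀ (T : Subring K) (hT : T ≤ O.toSubring), A.toSubring ≤ T → (subringCentre T O hT).IsMaximal) →
    ∀ (B' : Subalgebra k K) (hB'O : B'.toSubring ≤ O.toSubring), A ≤ B' → B'.FG →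
    ∀ u : ↥(locAtCentre B'.toSubring O), ∃ e : ↥(locAtCentre B'.toSubring O),
      u - e ^ p ∈ (haveI := isLocalRing_locAtCentre hB'O; IsLocalRing.maximalIdeal (locAtCentre B'.toSubring O)) := by
  intro k _ K _ _ _ p hp _ O A _ _ hzd B' hB'O hAB' hB'fg u
  classical
  haveI := isLocalRing_locAtCentre hB'O
  letI : Algebra k B'.toSubring := inferInstanceAs (Algebra k B')
  haveI : Algebra.FiniteType k B'.toSubring := (B'.fg_iff_finiteType.mp hB'fg : Algebra.FiniteType k B')
  set 𝔮 := subringCentre B'.toSubring O hB'O with h𝔮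
  haveI h𝔮max : 𝔮.IsMaximal := hzd _ hB'O (fun w hw => hAB' hw)
  letI : Field (↥B'.toSubring ⧸ 𝔮) := Ideal.Quotient.field 𝔮
  haveI : Algebra.FiniteType k (↥B'.toSubring ⧸ 𝔮) := inferInstance
  haveI : Module.Finite k (↥B'.toSubring ⧸ 𝔮) := finite_of_finite_type_of_isJacobsonRing k _
  haveI : Algebra.IsAlgebraic k (↥B'.toSubring ⧸ 𝔮) := Algebra.IsAlgebraic.of_finite k _
  haveI : PerfectField (↥B'.toSubring ⧸ 𝔮) := Algebra.IsAlgebraic.perfectField k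
  haveI : CharP (↥B'.toSubring ⧸ 𝔮) p := charP_of_injective_algebraMap (algebraMap k (↥B'.toSubring ⧸ 𝔮)).injective p
  -- `u = a / b`
  obtain ⟨a, ha, b, hb, hvb, hu⟩ := mem_locAtCentre_iff.mp u.2
  obtain ⟨e₁, he₁⟩ := surjective_frobenius (↥B'.toSubring ⧸ 𝔮) p (Ideal.Quotient.mk 𝔮 ⟨a, ha⟩)
  obtain ⟨e₂, he₂⟩ := surjective_frobenius (↥B'.toSubring ⧸ 𝔮) p (Ideal.Quotient.mk 𝔮 ⟨b, hb⟩)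
  obtain ⟨e₁, rfl⟩ := Ideal.Quotient.mk_surjective e₁
  obtain ⟨e₂, rfl⟩ := Ideal.Quotient.mk_surjective e₂
  have hcong : ∀ (e : ↥B'.toSubring) (c : K) (hc : c ∈ B'.toSubring),
      frobenius (↥B'.toSubring ⧸ 𝔮) p (Ideal.Quotient.mk 𝔮 e) = Ideal.Quotient.mk 𝔮 ⟨c, hc⟩ → O.valuation ((e : K) ^ p - c) < 1 := by
    intro e c hc he
    have hmem : e ^ p - ⟨c, hc⟩ ∈ 𝔮 := by
      rw [← Ideal.Quotient.eq_zero_iff_mem, map_sub, map_pow, ← frobenius_def, he, sub_self]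
    have := (mem_subringCentre_iff hB'O _).mp hmem
    simpa using this
  have h1 := hcong e₁ a ha he₁
  have h2 := hcong e₂ b hb he₂
  -- `v e₂ = 1`
  have hve₂p : O.valuation ((e₂ : K) ^ p) = 1 := by
    have : (e₂ : K) ^ p = ((e₂ : K) ^ p - b) + b := by ring
    rw [this, Valuation.map_add_eq_of_lt_right _ (by rw [hvb]; exact h2), hvb]
  have hve₂ : O.valuation (e₂ : K) = 1 := by
    rw [map_pow] at hve₂p
    exact (pow_eq_one_iff.mp hve₂p).resolve_right hp.out.ne_zero
  refine ⟨⟨(e₁ : K) / (e₂ : K), mem_locAtCentre_iff.mpr ⟨_, e₁.2, _, e₂.2, hve₂, rfl⟩⟩, ?_⟩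
  rw [mem_maximalIdeal_locAtCentre_iff hB'O]
  change O.valuation ((u : K) - ((e₁ : K) / (e₂ : K)) ^ p) < 1
  have he₂0 : (e₂ : K) ≠ 0 := ne_zero_of_valuation_eq_one hve₂
  have hb0 : b ≠ 0 := ne_zero_of_valuation_eq_one hvb
  have hcalc : (u : K) - ((e₁ : K) / (e₂ : K)) ^ p = (a * ((e₂ : K) ^ p - b) - b * ((e₁ : K) ^ p - a)) / (b * (e₂ : K) ^ p) := by
    rw [hu, div_pow, div_sub_div _ _ hb0 (pow_ne_zero _ he₂0)]; congr 1; ring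
  rw [hcalc, map_div₀, map_mul O.valuation b, hvb, hve₂p, one_mul, div_one]
  have hva : O.valuation a ≤ 1 := (O.valuation_le_one_iff _).mpr (hB'O ha)
  refine lt_of_le_of_lt (Valuation.map_sub _ _ _) (max_lt ?_ ?_)
  · rw [map_mul]
    calc O.valuation a * O.valuation ((e₂ : K) ^ p - b) ≤ 1 * O.valuation ((e₂ : K) ^ p - b) := by gcongr
      _ < 1 := by rw [one_mul]; exact h2
  · rw [map_mul, hvb, one_mul]; exact h1

end Summit.ResolutionOfSingularities.ResolutionOfSingularities.Theorems.RadicialJung.CleanModels.Ccurve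

end
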